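import Summits.BirchSwinnertonDyer.BirchSwinnertonDyer.Theorems.InertBadSignedBranchesCccOneLawOnTypeIstarZeroCollinearMuPrediction
import Summits.BirchSwinnertonDyer.BirchSwinnertonDyer.Theorems.InertBadSignedBranchesCccOneLawOnTypeIstarZeroMuDictionaryEtaKeying
import HarnessLib

set_option linter.dupNamespace false
set_option autoImplicit false

/-!
# Route `InertBadSignedBranches` (rung K8), crux 19223 `CccOneLawOnTypeIstarZero`, line `kato_perrin_riou_istar`:
# ON THE ROWS — stub 2b's sentence ⟺ «equal `μ` of two Coleman images», the frame supplied (helper `--supports stmt-BirchSwinnertonDyer-19223`)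

HONEST FRAMING (refill hand `leafhand-bsd-inertbadsignedbran-4`, LAND-ONLY): BSD is NOT proved by any of this; nothing
here closes a stub, an item or a cell; no definition, no new fact, no `sorry`; nothing is booked.

WHAT.  The rows-level form of `…CollinearMuPrediction` §6, with the `η`-frame SUPPLIED from tree theorems and print names
exactly as hand -3's `…MuDictionaryEtaKeying` §3 does (the CM good-supersingular twin
`X12.O10.exists_goodTwist_pStar_of_hasSignedLocalType_IstarZero`, modularity `exists_isNewformOf` = the line's
`stub_printFactsKato.2.1`, Mazur's `p ∤ c₀` for the period ratio, `K₀ = ℚ(μ_p)` with the quadratic `η`, a cyclotomic `(κ, γ)` on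
the cyclotomic variable).  RESULT `exists_colemanFunctional_stub2b_iff_onType_IstarZero_of_plusMCEtaKMuPart`: granted modularity,
Mazur, 19867 `PublishedInputsEtaUpToP`, 19865 `PlusMCEtaKMuPart` (resp. the registered stub 6a `PlusMCEtaK`) and the package fact
`Kobayashi2003.thm62_63_73_etaColemanPoitouTate`, for every `p ≥ 5` and every globally minimal `W` with
`HasSignedLocalType W p (I₀*)` (the row binders of RESEARCH stub 2b `KatoPerrinRiouIstar.stub_katoMuEqualityIstarZero`) there is a
cyclotomic datum `(κ, γ)` such that on EVERY pin `I : 𝐇¹_Γ(T_pW)` over it there are an INJECTIVE `Λ`-linear `c : 𝐇¹_Γ → Λ`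
(Kobayashi's `Col⁺ ∘ loc`) and a class `z` (his `η`-class) with: (i) stub 2b's sentence holds AT `z` for every contragredient `Y`;
(ii) for every ADMISSIBLE `z₀`, stub 2b's sentence at `z₀` ⟺ `length_(p) (Λ ⧸ (c z₀)) = length_(p) (Λ ⧸ (c z))`.  So on the rows,
in the keying `(κ, γ)` (the other keyings by hand -3's Keying §1–§2), stub 2b is the equality of the `μ`-invariants of two power
series `c z₀`, `c z ∈ Λ` — NOT asserted.

References: [Kobayashi2003] Thm. 6.3 (p. 11), Thm. 7.3 i) (7.21) and proof of Thm. 7.4 (p. 13); [Kato2004Asterisque] Conj. 12.10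
(p. 224); [BurungaleTian2026] Rem. 2.7 (p. 5); [Mazur1978] Cor. 4.1; [SerreInventiones1972] §1.11 Prop. 12; [Washington1997] §13.2.
-/

noncomputable section

open scoped Classical

open CongruenceSubgroup WeierstrassCurve Field Literature.NumberTheory.EllipticCurves
  Literature.NumberTheory.EllipticCurves.ModularForms Literature.NumberTheory.GaloisRepresentations
  Literature.NumberTheory.EllipticCurves.IwasawaAlgebra Literature.NumberTheory.EllipticCurves.Module
  Literature.NumberTheory.EllipticCurves.Kato2004 ZpExtension Summit.BirchSwinnertonDyer.Rank1Residual
  Summit.BirchSwinnertonDyer.Rank1Residual.Additive Summit.BirchSwinnertonDyer.Rank1Residual.X12.O10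
  Summit.BirchSwinnertonDyer.BirchSwinnertonDyer.Theses.InertBadSignedBranches
  Summit.BirchSwinnertonDyer.BirchSwinnertonDyer.Theorems.CccOneMuDictionaryEta

namespace Summit.BirchSwinnertonDyer.BirchSwinnertonDyer.Theorems.CccOneCollinearMu

/-! ## §7 On the rows of crux 19223 -/

/-- **ON THE ROWS: stub 2b's sentence ⟺ «`length_(p) (Λ ⧸ (c z₀)) = length_(p) (Λ ⧸ (c z))`» for an injective Coleman functional `c`
and a class `z` at which the sentence HOLDS — the frame supplied.**  Granted modularity (`hnf`), Mazur (`hM`), 19867 (`hF`), 19865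
(`hμ`) and the Kobayashi package fact (`hT`): for every `p ≥ 5`, every globally minimal `W/ℚ` with `HasSignedLocalType W p (I₀*)`,
there are a cyclotomic `κ` with topological generator `γ` such that for every pin `I : 𝐇¹_Γ(T_pW)` over `(κ, γ)` there are an
injective `Λ`-linear `c : I.H → Λ` and `z ∈ I.H` with (i) `length_(p) Y.X = length_(p) (I.H ⧸ Λ∙z)` for every contragredient
`Y : W.FineSelmerDualData κ γ⁻¹`, and (ii) for every admissible `z₀` and every such `Y`:
`length_(p) Y.X = length_(p) (I.H ⧸ Λ∙z₀) ↔ length_(p) (Λ ⧸ (c z₀)) = length_(p) (Λ ⧸ (c z))`.  (`c = Col⁺ ∘ loc`, `z` = Kobayashi's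
`η`-class, `c z = L_p⁺(V, η, X)` up to `ℤ_pˣ`.)  CONDITIONAL on the named inputs; nothing asserted.
[cite: Kobayashi2003, Thm. 6.3 (p. 11), Thm. 7.3 i) and proof of Thm. 7.4 (p. 13)] [cite: Kato2004Asterisque, Conj. 12.10 (p. 224)]
[cite: Mazur1978, Cor. 4.1] [cite: SerreInventiones1972, §1.11 Prop. 12] [cite: BurungaleTian2026, Rem. 2.7 (p. 5)] -/
theorem exists_colemanFunctional_stub2b_iff_onType_IstarZero_of_plusMCEtaKMuPart
    (hnf : exists_isNewformOf) (hM : mazur_not_dvd_maninConstant_of_odd)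
    (hF : PublishedInputsEtaUpToP) (hμ : PlusMCEtaKMuPart)
    (hT : Kobayashi2003.thm62_63_73_etaColemanPoitouTate) :
    ∀ (p : ℕ) [Fact p.Prime], 5 ≤ p → ∀ (W : WeierstrassCurve ℚ) [W.IsElliptic] [W.IsGloballyMinimal],
      HasSignedLocalType W p (.Istar 0) →
      letI : ContinuousSMul ℤ_[p] (W.tateModule p) := TateModule.continuousSMul_padicInt
      ∃ (κ : ZpExtension ℚ p) (hκ : κ.IsCyclotomic) (γ : Field.absoluteGaloisGroup ℚ) (_ : κ.IsTopGenerator γ),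
        ∀ (I : IwasawaH1Data W p κ γ),
          ∃ (c : I.H →ₗ[IwasawaAlgebra p] IwasawaAlgebra p) (z : I.H), Function.Injective c ∧
            (∀ (Y : W.FineSelmerDualData κ γ⁻¹) (𝔮 : PrimeSpectrum (IwasawaAlgebra p)),
              𝔮.asIdeal = IwasawaAlgebra.augIdealP p →
                Module.lengthAt (IwasawaAlgebra p) Y.X 𝔮 =
                  Module.lengthAt (IwasawaAlgebra p) (I.H ⧸ (IwasawaAlgebra p) ∙ z) 𝔮) ∧
            ∀ (z₀ : I.H), IsAdmissibleZetaClass W p κ hκ I z₀ →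
              ∀ (Y : W.FineSelmerDualData κ γ⁻¹) (𝔮 : PrimeSpectrum (IwasawaAlgebra p)),
                𝔮.asIdeal = IwasawaAlgebra.augIdealP p →
                (Module.lengthAt (IwasawaAlgebra p) Y.X 𝔮 =
                    Module.lengthAt (IwasawaAlgebra p) (I.H ⧸ (IwasawaAlgebra p) ∙ z₀) 𝔮 ↔
                  Module.lengthAt (IwasawaAlgebra p) (IwasawaAlgebra p ⧸ Ideal.span {c z₀}) 𝔮 =
                    Module.lengthAt (IwasawaAlgebra p) (IwasawaAlgebra p ⧸ Ideal.span {c z}) 𝔮) := by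
  intro p _ hp5 W _ _ hTy
  letI : ContinuousSMul ℤ_[p] (W.tateModule p) := TateModule.continuousSMul_padicInt
  have hp2 : p ≠ 2 := by omega
  -- the CM good-supersingular twin, its newform (modularity), its period ratio (Mazur) — as in hand -3's Keying §3
  obtain ⟨V, hVe, hVm, C, hC, hgood, hap, hCM, -, -⟩ :=
    exists_goodTwist_pStar_of_hasSignedLocalType_IstarZero W hTy hp5
  haveI : NeZero (V.conductorNorm ℤ) := ⟨(V.conductorNorm_pos_holds).ne'⟩
  obtain ⟨f, hf⟩ := hnf V
  obtain ⟨ϖ, -, hϖ⟩ := periodRatio_of_mazur p hM hp5 V f hf hgood hap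
  -- the η-frame: `K₀ = ℚ(μ_p)`, the quadratic `η`, a cyclotomic `(κ, γ)` on the cyclotomic variable inside `Gal(ℚ̄/K₀)`
  haveI : NeZero p := ⟨(Fact.out : p.Prime).ne_zero⟩
  haveI : IsCyclotomicExtension {p} ℚ (CyclotomicField p ℚ) := CyclotomicField.isCyclotomicExtension p ℚ
  haveI : (galRange (K := ℚ) (CyclotomicField p ℚ)).Normal := normal_galRange_cyclotomic p _
  obtain ⟨θ, η, -, -, -, hηK, hη1⟩ := SignedTwist.exists_theta_eta_cyclotomicField p hp2
  obtain ⟨κ, hκ, γ₁, hγ₁, hγ₁c⟩ := exists_isCyclotomic_isTopGenerator_isCyclotomicVariable_holds p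
  obtain ⟨γ, hγK, hγκ⟩ := kappa_surjOn_galRange_cyclotomic κ (CyclotomicField p ℚ) (κ γ₁)
  have hγ : κ.IsTopGenerator γ := by rw [ZpExtension.IsTopGenerator, hγκ]; exact hγ₁
  have hγγ : γ₁⁻¹ * γ ∈ κ.kerSubgroup := by
    rw [ZpExtension.mem_kerSubgroup, map_mul, map_inv, hγκ, inv_mul_cancel]
  have hγc : IsCyclotomicVariable p γ := SignedTwist.isCyclotomicVariable_of_inv_mul_mem_ker hκ hγγ hγ₁c
  refine ⟨κ, hκ, γ, hγ, fun I => ?_⟩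
  -- a pinned `X₀` of key `γ` and a Kobayashi package on the pin `I` itself
  obtain ⟨FB⟩ := W.nonempty_fineSelmerDualData κ hγ
  obtain ⟨P⟩ := hT p (CyclotomicField p ℚ) η hηK hη1 V hp2 hgood hap hf ϖ hϖ κ γ hκ hγ hγK hγc W C hC I FB
  exact ⟨P.colPlus, P.z, P.colPlus_injective,
    fun Y 𝔮 h𝔮 => lengthAt_contra_fine_eq_lengthAt_quotient_of_plusMCEtaKMuPart hp2 (CyclotomicField p ℚ) η hηK hη1
      V hCM hgood hap hf ϖ hϖ κ γ hκ hγ hγK hγc W I FB P hF hμ Y 𝔮 h𝔮,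
    fun z₀ h₀ Y 𝔮 h𝔮 => stub2b_sentence_iff_lengthAt_colPlus_of_plusMCEtaKMuPart hp2 (CyclotomicField p ℚ) η hηK hη1
      V hCM hgood hap hf ϖ hϖ κ γ hκ hγ hγK hγc W I FB P hF hμ Y h₀ 𝔮 h𝔮⟩

/-- **The same keyed to the registered ROUTE-CRUX stub 6a `PlusMCEtaK` (item 19501) instead of its `μ`-part 19865** (via the
kernel `μ`-criterion `PlusMCEtaKUpToMu.plusMCEtaK_iff_muInvariant_eq_of_burungaleTian`, granted 19867).
[cite: Kobayashi2003, proof of Thm. 7.4 (p. 13)] [cite: BurungaleTian2026, Thm. 2.6 and Rem. 2.7 (p. 5)] -/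
theorem exists_colemanFunctional_stub2b_iff_onType_IstarZero_of_plusMCEtaK
    (hnf : exists_isNewformOf) (hM : mazur_not_dvd_maninConstant_of_odd)
    (hF : PublishedInputsEtaUpToP) (hK6 : PlusMCEtaK)
    (hT : Kobayashi2003.thm62_63_73_etaColemanPoitouTate) :
    ∀ (p : ℕ) [Fact p.Prime], 5 ≤ p → ∀ (W : WeierstrassCurve ℚ) [W.IsElliptic] [W.IsGloballyMinimal],
      HasSignedLocalType W p (.Istar 0) →
      letI : ContinuousSMul ℤ_[p] (W.tateModule p) := TateModule.continuousSMul_padicInt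
      ∃ (κ : ZpExtension ℚ p) (hκ : κ.IsCyclotomic) (γ : Field.absoluteGaloisGroup ℚ) (_ : κ.IsTopGenerator γ),
        ∀ (I : IwasawaH1Data W p κ γ),
          ∃ (c : I.H →ₗ[IwasawaAlgebra p] IwasawaAlgebra p) (z : I.H), Function.Injective c ∧
            (∀ (Y : W.FineSelmerDualData κ γ⁻¹) (𝔮 : PrimeSpectrum (IwasawaAlgebra p)),
              𝔮.asIdeal = IwasawaAlgebra.augIdealP p →
                Module.lengthAt (IwasawaAlgebra p) Y.X 𝔮 =
                  Module.lengthAt (IwasawaAlgebra p) (I.H ⧸ (IwasawaAlgebra p) ∙ z) 𝔮) ∧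
            ∀ (z₀ : I.H), IsAdmissibleZetaClass W p κ hκ I z₀ →
              ∀ (Y : W.FineSelmerDualData κ γ⁻¹) (𝔮 : PrimeSpectrum (IwasawaAlgebra p)),
                𝔮.asIdeal = IwasawaAlgebra.augIdealP p →
                (Module.lengthAt (IwasawaAlgebra p) Y.X 𝔮 =
                    Module.lengthAt (IwasawaAlgebra p) (I.H ⧸ (IwasawaAlgebra p) ∙ z₀) 𝔮 ↔
                  Module.lengthAt (IwasawaAlgebra p) (IwasawaAlgebra p ⧸ Ideal.span {c z₀}) 𝔮 =
                    Module.lengthAt (IwasawaAlgebra p) (IwasawaAlgebra p ⧸ Ideal.span {c z}) 𝔮) := by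
  have hμ : PlusMCEtaKMuPart := by
    intro p _ hp K₀ _ _ _ _ η hη hη1 V _ _ N _ f hCM hgood hap hf ϖ hϖ κ γ hκ hγ hγK hvar Lp hLp D
    exact (PlusMCEtaKUpToMu.plusMCEtaK_iff_muInvariant_eq_of_burungaleTian hF.1 hF.2 p hp K₀ η hη hη1 V hCM
      hgood hap hf ϖ hϖ κ γ hκ hγ hγK hvar Lp hLp D).mp
      (hK6 p hp K₀ η hη hη1 V hCM hgood hap hf ϖ hϖ κ γ hκ hγ hγK hvar Lp hLp D)
  exact exists_colemanFunctional_stub2b_iff_onType_IstarZero_of_plusMCEtaKMuPart hnf hM hF hμ hT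

end Summit.BirchSwinnertonDyer.BirchSwinnertonDyer.Theorems.CccOneCollinearMu

end
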